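import Literature.NumberTheory.LFunctions.Zhang2022.DetectorTwoSidedArcs

/-!
# Two-sided doubling, calculus half (ii): Parseval on a period cell from the two TRANSFORM RULES, and the glued
# periodic two-piece inequality with the right piece's second rule supplied by an integration-by-parts IDENTITY

Y. Zhang, *Discrete mean estimates and the Landau–Siegel zero*, arXiv:2211.02515v1 [Zhang2022LandauSiegel] —
an unrefereed manuscript under adjudication. **WHAT THIS IS NOT: not a claim about Theorems 1–2 of
arXiv:2211.02515, about Landau–Siegel zeros, about a repaired `Margin232`, or about Parity; nothing here asserts
E-102, the E-010 slot or any registry row. The programme SEARCHES and TYPES; no claim about Landau–Siegel zeros,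
Theorems 1–2 of arXiv:2211.02515 or a repaired Margin232 until a kernel theorem says so.**

CONTEXT (cell landau-siegel §E, row S-E-p5-13 / S-E-p6-3; ls-barrier-p6 g3's slot `Det.GluedFormPSD b` is stated
for ALL glued sides `Det.GluedSides`, i.e. bare one-sided kinked profiles with RIGHT-derivatives only). The circle
function of the two-sided assembly carries side 2 REFLECTED (`y ↦ 1−y`), so the pointwise right-derivative
hypotheses of [K3′] (`Det.bulkFormOn_circle_nonneg_of_signAdmissible`) would ask for LEFT-derivatives of the side-2
profile, which `Repair.KinkedProfile` does not supply. This file removes that obstruction: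

* Part 1: `hasSum_bulkFormOn_cell_of_rules` / `bulkFormOn_cell_nonneg_of_rules_of_signAdmissible` — the Parseval
  diagonalisation of [K3′] (ls-Bmulti-typer-2 g3, p488397) with the two transform rules `D_{S′}(m) = iπm·D_S(m)`,
  `D_{S″}(m) = iπm·D_{S′}(m)` taken as HYPOTHESES (same algebra, `Det.hasSum_conj_dpiece_cell_mul`);
* Part 2: `bulkFormOn_periodic_two_piece_nonneg_of_ibp` — pieces `L` on `[−1,0]`, `R` on `[0,1]`, `C¹` and periodic
  `C¹` matching, `L → L′ → L″` and `R → R′` by right-derivatives, and `R′ → R″` by the per-piece IBP IDENTITY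
  `∫₀¹ R″k_m = R′(1)k_m(1) − R′(0)k_m(0) + iπm·∫₀¹ R′k_m` (the conclusion of `Det.dpiece_deriv`, not its hypotheses):
  `0 ≤ T_b^{[−1,0]}(L) + T_b^{[0,1]}(R)` for sign-admissible `b`;
Consumed by `DetectorTwoSidedGlued` (the reflected arc's IBP identity by change of variables, and the [K6″]
composition on ALL of `Det.GluedSides`). 0 named facts, 0 `def`s,
0 sorries; standard axioms. Cell landau-siegel, ls-barrier-p5 g4. References: Y. Zhang, arXiv:2211.02515v1 (2022),
Prop. 7.1 p.44 with (7.2), (8.11)–(8.23), §12 (12.6)–(12.8); Y. Katznelson, *An introduction to harmonic analysis*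
(2004) Ch. I §5 [Katznelson2004]. [cite: Zhang2022LandauSiegel, Prop 7.1 p.44 with (7.2), (8.11)–(8.23)]
-/

noncomputable section

open Complex Real Set intervalIntegral Filter Topology
open _root_.MeasureTheory
open scoped ComplexConjugate

namespace Literature.NumberTheory.LFunctions.Zhang2022

namespace Det

open Repair

variable {b : Fin 3 → ℝ}

/-! ### Part 1 — Parseval on a period cell from the two transform rules -/

section Rules

variable {S S' S'' : ℝ → ℂ}

/-- The four lattice summands from the two transform rules (pure algebra, as in [K3′]). [folklore] -/
private theorem pairing_terms_of_rules (m : ℤ) {D D' D'' : ℂ} (hd1 : D' = I * π * (m : ℂ) * D)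
    (hd2 : D'' = I * π * (m : ℂ) * D') :
    conj D'' * D'' = (((π ^ 4 * (m : ℝ) ^ 4 * ‖D‖ ^ 2 : ℝ)) : ℂ)
    ∧ conj D' * D'' = I * ((((π ^ 3 * (m : ℝ) ^ 3 * ‖D‖ ^ 2) : ℝ)) : ℂ)
    ∧ conj D' * D' = (((π ^ 2 * (m : ℝ) ^ 2 * ‖D‖ ^ 2 : ℝ)) : ℂ)
    ∧ conj D * D' = I * ((((π * (m : ℝ) * ‖D‖ ^ 2) : ℝ)) : ℂ) := by
  have hsq' : conj D * D = ((‖D‖ : ℂ)) ^ 2 := by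
    rw [Complex.conj_mul']
  have hI : I * I = -1 := Complex.I_mul_I
  refine ⟨?_, ?_, ?_, ?_⟩
  · rw [hd2, hd1]
    simp only [map_mul, Complex.conj_I, Complex.conj_ofReal, map_intCast]
    push_cast
    linear_combination ((π : ℂ) ^ 4 * (m : ℂ) ^ 4 * I ^ 4) * hsq'
      + ((π : ℂ) ^ 4 * (m : ℂ) ^ 4 * ((‖D‖ : ℂ)) ^ 2 * (I * I - 1)) * hI
  · rw [hd2, hd1]
    simp only [map_mul, Complex.conj_I, Complex.conj_ofReal, map_intCast]
    push_cast
    linear_combination (-(I ^ 3) * (π : ℂ) ^ 3 * (m : ℂ) ^ 3) * hsq'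
      + (-(I * (π : ℂ) ^ 3 * (m : ℂ) ^ 3 * ((‖D‖ : ℂ)) ^ 2)) * hI
  · rw [hd1]
    simp only [map_mul, Complex.conj_I, Complex.conj_ofReal, map_intCast]
    push_cast
    linear_combination (-(I ^ 2) * (π : ℂ) ^ 2 * (m : ℂ) ^ 2) * hsq'
      + (-((π : ℂ) ^ 2 * (m : ℂ) ^ 2 * ((‖D‖ : ℂ)) ^ 2)) * hI
  · rw [hd1]
    push_cast
    linear_combination (I * (π : ℂ) * (m : ℂ)) * hsq'

/-- **Parseval on the period cell `[c, c+2]` from the two TRANSFORM RULES**: for `S, S′` continuous on the closed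
cell, `S″ ∈ L²`, and `D_{S′}(m) = iπm·D_S(m)`, `D_{S″}(m) = iπm·D_{S′}(m)` for every `m ∈ ℤ`
(`D_F(m) = Det.dpiece c (c+2) F m`):
`HasSum (m ↦ (π⁴/2)·(m⁴ + e₁m³ + e₂m² + e₃m)·|D_S(m)|²) (T_b^{[c,c+2]}(S))` — the algebra of [K3′] verbatim, its
pointwise-derivative hypotheses replaced by their two consequences. [cite: Zhang2022LandauSiegel, Prop 7.1 p.44 with (7.2), (8.11)–(8.23)] -/
theorem hasSum_bulkFormOn_cell_of_rules (b : Fin 3 → ℝ) (c : ℝ) (hS : ContinuousOn S (Icc c (c + 2)))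
    (hS' : ContinuousOn S' (Icc c (c + 2))) (hS''m : MemLp S'' 2 (volume.restrict (Ioc c (c + 2))))
    (hd1 : ∀ m : ℤ, dpiece c (c + 2) S' m = I * π * m * dpiece c (c + 2) S m)
    (hd2 : ∀ m : ℤ, dpiece c (c + 2) S'' m = I * π * m * dpiece c (c + 2) S' m) :
    HasSum (fun m : ℤ => π ^ 4 / 2 *
        (((m : ℝ) ^ 4 + (b 0 + b 1 + b 2) * (m : ℝ) ^ 3 + (b 0 * b 1 + b 1 * b 2 + b 2 * b 0) * (m : ℝ) ^ 2
          + (b 0 * b 1 * b 2) * (m : ℝ)) * ‖dpiece c (c + 2) S m‖ ^ 2))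
      (bulkFormOn b c (c + 2) S S' S'') := by
  have mS : MemLp S 2 (volume.restrict (Ioc c (c + 2))) := memLp_two_of_continuousOn_Icc' hS
  have mS' : MemLp S' 2 (volume.restrict (Ioc c (c + 2))) := memLp_two_of_continuousOn_Icc' hS'
  have hA := hasSum_conj_dpiece_cell_mul c hS''m hS''m
  have hB := hasSum_conj_dpiece_cell_mul c mS' hS''m
  have hC := hasSum_conj_dpiece_cell_mul c mS' mS'
  have hD := hasSum_conj_dpiece_cell_mul c mS mS'
  have tt := fun m : ℤ => pairing_terms_of_rules (D := dpiece c (c + 2) S m) m (hd1 m) (hd2 m)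
  have tA : (fun m : ℤ => conj (dpiece c (c + 2) S'' m) * dpiece c (c + 2) S'' m)
      = fun m : ℤ => (((π ^ 4 * (m : ℝ) ^ 4 * ‖dpiece c (c + 2) S m‖ ^ 2 : ℝ)) : ℂ) :=
    funext fun m => (tt m).1
  have tB : (fun m : ℤ => conj (dpiece c (c + 2) S' m) * dpiece c (c + 2) S'' m)
      = fun m : ℤ => I * ((((π ^ 3 * (m : ℝ) ^ 3 * ‖dpiece c (c + 2) S m‖ ^ 2) : ℝ)) : ℂ) :=
    funext fun m => (tt m).2.1
  have tC : (fun m : ℤ => conj (dpiece c (c + 2) S' m) * dpiece c (c + 2) S' m)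
      = fun m : ℤ => (((π ^ 2 * (m : ℝ) ^ 2 * ‖dpiece c (c + 2) S m‖ ^ 2 : ℝ)) : ℂ) :=
    funext fun m => (tt m).2.2.1
  have tD : (fun m : ℤ => conj (dpiece c (c + 2) S m) * dpiece c (c + 2) S' m)
      = fun m : ℤ => I * ((((π * (m : ℝ) * ‖dpiece c (c + 2) S m‖ ^ 2) : ℝ)) : ℂ) :=
    funext fun m => (tt m).2.2.2
  rw [tA] at hA; rw [tB] at hB; rw [tC] at hC; rw [tD] at hD
  have rA : HasSum (fun m : ℤ => π ^ 4 * (m : ℝ) ^ 4 * ‖dpiece c (c + 2) S m‖ ^ 2)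
      (2 * ∫ y in c..c + 2, conj (S'' y) * S'' y).re := by
    have := Complex.hasSum_re hA
    simpa only [Complex.ofReal_re] using this
  have iB : HasSum (fun m : ℤ => π ^ 3 * (m : ℝ) ^ 3 * ‖dpiece c (c + 2) S m‖ ^ 2)
      (2 * ∫ y in c..c + 2, conj (S' y) * S'' y).im := by
    have := Complex.hasSum_im hB
    simpa only [Complex.I_mul_im, Complex.ofReal_re] using this
  have rC : HasSum (fun m : ℤ => π ^ 2 * (m : ℝ) ^ 2 * ‖dpiece c (c + 2) S m‖ ^ 2)
      (2 * ∫ y in c..c + 2, conj (S' y) * S' y).re := by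
    have := Complex.hasSum_re hC
    simpa only [Complex.ofReal_re] using this
  have iD : HasSum (fun m : ℤ => π * (m : ℝ) * ‖dpiece c (c + 2) S m‖ ^ 2)
      (2 * ∫ y in c..c + 2, conj (S y) * S' y).im := by
    have := Complex.hasSum_im hD
    simpa only [Complex.I_mul_im, Complex.ofReal_re] using this
  set e1 : ℝ := b 0 + b 1 + b 2 with he1
  set e2 : ℝ := b 0 * b 1 + b 1 * b 2 + b 2 * b 0 with he2
  set e3 : ℝ := b 0 * b 1 * b 2 with he3
  have goal := ((rA.mul_left (1 / 2 : ℝ)).add ((iB.mul_left (π * e1 / 2)).add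
    ((rC.mul_left (π ^ 2 * e2 / 2)).add (iD.mul_left (π ^ 3 * e3 / 2)))))
  have hfun : (fun m : ℤ => 1 / 2 * (π ^ 4 * (m : ℝ) ^ 4 * ‖dpiece c (c + 2) S m‖ ^ 2)
      + (π * e1 / 2 * (π ^ 3 * (m : ℝ) ^ 3 * ‖dpiece c (c + 2) S m‖ ^ 2)
        + (π ^ 2 * e2 / 2 * (π ^ 2 * (m : ℝ) ^ 2 * ‖dpiece c (c + 2) S m‖ ^ 2)
          + π ^ 3 * e3 / 2 * (π * (m : ℝ) * ‖dpiece c (c + 2) S m‖ ^ 2))))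
      = fun m : ℤ => π ^ 4 / 2 *
        (((m : ℝ) ^ 4 + e1 * (m : ℝ) ^ 3 + e2 * (m : ℝ) ^ 2 + e3 * (m : ℝ)) * ‖dpiece c (c + 2) S m‖ ^ 2) := by
    funext m; ring
  have hval : bulkFormOn b c (c + 2) S S' S''
      = 1 / 2 * (2 * ∫ y in c..c + 2, conj (S'' y) * S'' y).re
        + (π * e1 / 2 * (2 * ∫ y in c..c + 2, conj (S' y) * S'' y).im
          + (π ^ 2 * e2 / 2 * (2 * ∫ y in c..c + 2, conj (S' y) * S' y).re
            + π ^ 3 * e3 / 2 * (2 * ∫ y in c..c + 2, conj (S y) * S' y).im)) := by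
    rw [bulkFormOn_eq_pairings b (cell_lt' c).le hS hS' hS''m]
    simp only [← he1, ← he2, ← he3, Complex.mul_re, Complex.mul_im, Complex.re_ofNat, Complex.im_ofNat,
      zero_mul, sub_zero, add_zero]
    ring
  rw [hfun, ← hval] at goal
  exact goal

/-- **The bulk form on a period cell is `≥ 0` for a sign-admissible triple, given the two transform rules**
(Part 1 ∘ `SignAdmissible.bulkSymbol_intCast_nonneg`). [cite: Zhang2022LandauSiegel, Prop 7.1 p.44 with (7.2), (8.11)–(8.23)] -/
theorem bulkFormOn_cell_nonneg_of_rules_of_signAdmissible (hb : SignAdmissible b) (c : ℝ)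
    (hS : ContinuousOn S (Icc c (c + 2))) (hS' : ContinuousOn S' (Icc c (c + 2)))
    (hS''m : MemLp S'' 2 (volume.restrict (Ioc c (c + 2))))
    (hd1 : ∀ m : ℤ, dpiece c (c + 2) S' m = I * π * m * dpiece c (c + 2) S m)
    (hd2 : ∀ m : ℤ, dpiece c (c + 2) S'' m = I * π * m * dpiece c (c + 2) S' m) :
    0 ≤ bulkFormOn b c (c + 2) S S' S'' := by
  refine (hasSum_bulkFormOn_cell_of_rules b c hS hS' hS''m hd1 hd2).nonneg fun m => ?_
  have hσ := hb.bulkSymbol_intCast_nonneg m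
  rw [bulkSymbol_eq_poly] at hσ
  positivity

end Rules

/-! ### Part 2 — the glued periodic two-piece inequality, second rule of the right piece by an IBP identity -/

section Glued

variable {L L' L'' R R' R'' : ℝ → ℂ}

/-- Continuity of a glued function on the cell from continuity of the pieces and matching at `0`. [folklore] -/
private theorem continuousOn_glue_cell' (hLc : ContinuousOn L (Icc (-1:ℝ) 0)) (hRc : ContinuousOn R (Icc (0:ℝ) 1))
    (hm : L 0 = R 0) : ContinuousOn (glue L R) (Icc (-1:ℝ) 1) := by
  unfold glue
  refine ContinuousOn.piecewise ?_ ?_ ?_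
  · rintro a ⟨-, ha⟩
    rw [frontier_Iic, mem_singleton_iff] at ha
    rw [ha]; exact hm
  · rw [closure_Iic]
    exact hLc.mono fun y hy => ⟨hy.1.1, hy.2⟩
  · rw [compl_Iic, closure_Ioi]
    exact hRc.mono fun y hy => ⟨hy.2, hy.1.2⟩

/-- Right-derivatives of a glued function at the interior points of the left piece. [folklore] -/
private theorem hasDerivWithinAt_glue_left' {f f' g g' : ℝ → ℂ} {y : ℝ} (hy : y < 0)
    (h : HasDerivWithinAt f (f' y) (Ioi y) y) : HasDerivWithinAt (glue f g) (glue f' g' y) (Ioi y) y := by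
  rw [glue_of_le hy.le]
  refine h.congr_of_eventuallyEq ?_ (glue_of_le hy.le)
  exact Filter.eventuallyEq_of_mem (Ioo_mem_nhdsGT hy) fun z hz => glue_of_le hz.2.le

/-- Right-derivatives of a glued function at the interior points of the right piece. [folklore] -/
private theorem hasDerivWithinAt_glue_right' {f f' g g' : ℝ → ℂ} {y : ℝ} (hy : 0 < y)
    (h : HasDerivWithinAt g (g' y) (Ioi y) y) : HasDerivWithinAt (glue f g) (glue f' g' y) (Ioi y) y := by
  rw [glue_of_pos hy]
  refine h.congr_of_eventuallyEq ?_ (glue_of_pos hy)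
  exact Filter.eventuallyEq_of_mem self_mem_nhdsWithin fun z hz => glue_of_pos (hy.trans hz)

/-- The transform of a glued function over the left half is that of the left piece. [folklore] -/
private theorem dpiece_glue_left (f g : ℝ → ℂ) (m : ℤ) : dpiece (-1) 0 (glue f g) m = dpiece (-1) 0 f m := by
  unfold dpiece
  refine intervalIntegral.integral_congr fun y hy => ?_
  rw [uIcc_of_le (by norm_num)] at hy
  simp only [glue_of_le hy.2]

/-- The transform of a glued function over the right half is that of the right piece. [folklore] -/
private theorem dpiece_glue_right (f g : ℝ → ℂ) (m : ℤ) : dpiece 0 1 (glue f g) m = dpiece 0 1 g m := by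
  unfold dpiece
  refine intervalIntegral.integral_congr_ae (ae_of_all _ fun y hy => ?_)
  rw [uIoc_of_le zero_le_one] at hy
  simp only [glue_of_pos hy.1]

/-- **The periodic two-piece bulk form is `≥ 0` for a sign-admissible triple, the right piece's second rule given
by an IBP identity.** Pieces `L` on `[−1,0]`, `R` on `[0,1]`, each continuous with continuous first derivative,
right-derivatives `L → L′ → L″` on `(−1,0)` and `R → R′` on `(0,1)`, `L″, R″ ∈ L²`, `C¹` matching at `0` and periodic
`C¹` matching (`L(−1) = R(1)`, `L′(−1) = R′(1)`), and for every `m ∈ ℤ` the per-piece identity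
`∫₀¹ R″k_m = R′(1)k_m(1) − R′(0)k_m(0) + iπm·∫₀¹ R′k_m` (what `Det.dpiece_deriv` would give from right-derivatives
`R′ → R″`, but may come from elsewhere — e.g. `reflArc_ibp`): `0 ≤ T_b^{[−1,0]}(L) + T_b^{[0,1]}(R)`.
[cite: Zhang2022LandauSiegel, Prop 7.1 p.44 with (7.2), (8.11)–(8.23)] -/
theorem bulkFormOn_periodic_two_piece_nonneg_of_ibp (hb : SignAdmissible b)
    (hLc : ContinuousOn L (Icc (-1:ℝ) 0)) (hL'c : ContinuousOn L' (Icc (-1:ℝ) 0))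
    (hL''m : MemLp L'' 2 (volume.restrict (Ioc (-1:ℝ) 0)))
    (hLd : ∀ y ∈ Ioo (-1:ℝ) 0, HasDerivWithinAt L (L' y) (Ioi y) y)
    (hL'd : ∀ y ∈ Ioo (-1:ℝ) 0, HasDerivWithinAt L' (L'' y) (Ioi y) y)
    (hRc : ContinuousOn R (Icc (0:ℝ) 1)) (hR'c : ContinuousOn R' (Icc (0:ℝ) 1))
    (hR''m : MemLp R'' 2 (volume.restrict (Ioc (0:ℝ) 1)))
    (hRd : ∀ y ∈ Ioo (0:ℝ) 1, HasDerivWithinAt R (R' y) (Ioi y) y)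
    (hRibp : ∀ m : ℤ, dpiece 0 1 R'' m
      = R' 1 * cexp (-(I * π * m * ((1:ℝ) : ℂ))) - R' 0 * cexp (-(I * π * m * ((0:ℝ) : ℂ)))
        + I * π * m * dpiece 0 1 R' m)
    (hm0 : L 0 = R 0) (hm1 : L' 0 = R' 0) (hp0 : L (-1) = R 1) (hp1 : L' (-1) = R' 1) :
    0 ≤ bulkFormOn b (-1) 0 L L' L'' + bulkFormOn b 0 1 R R' R'' := by
  classical
  have hFc : ContinuousOn (glue L R) (Icc (-1:ℝ) 1) := continuousOn_glue_cell' hLc hRc hm0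
  have hF'c : ContinuousOn (glue L' R') (Icc (-1:ℝ) 1) := continuousOn_glue_cell' hL'c hR'c hm1
  have hF''m : MemLp (glue L'' R'') 2 (volume.restrict (Ioc (-1:ℝ) 1)) := memLp_glue hL''m hR''m
  have hFd : ∀ y ∈ Ioo (-1:ℝ) 1, y ∉ ({0} : Finset ℝ) →
      HasDerivWithinAt (glue L R) (glue L' R' y) (Ioi y) y := by
    intro y hy hyN
    have hy0 : y ≠ 0 := fun h => hyN (by simp [h])
    rcases lt_or_gt_of_ne hy0 with h | h
    · exact hasDerivWithinAt_glue_left' h (hLd y ⟨hy.1, h⟩)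
    · exact hasDerivWithinAt_glue_right' h (hRd y ⟨h, hy.2⟩)
  have hper0 : glue L R (-1) = glue L R 1 := by
    rw [glue_of_le (by norm_num), glue_of_pos one_pos, hp0]
  -- integrability of the glued derivative data on the two halves
  have hL'i : IntervalIntegrable L' volume (-1) 0 := hL'c.intervalIntegrable_of_Icc (by norm_num)
  have hR'i : IntervalIntegrable R' volume 0 1 := hR'c.intervalIntegrable_of_Icc zero_le_one
  have hL''i : IntervalIntegrable L'' volume (-1) 0 := intervalIntegrable_of_memLp_Ioc (by norm_num) hL''m
  have hR''i : IntervalIntegrable R'' volume 0 1 := intervalIntegrable_of_memLp_Ioc zero_le_one hR''m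
  have gl : ∀ {f g : ℝ → ℂ}, IntervalIntegrable f volume (-1) 0 → IntervalIntegrable g volume 0 1 →
      IntervalIntegrable (glue f g) volume (-1) 0 ∧ IntervalIntegrable (glue f g) volume 0 1 := by
    intro f g hf hg
    have h := (integral_glue hf hg).1
    refine ⟨h.mono_set ?_, h.mono_set ?_⟩
    · rw [uIcc_of_le (by norm_num), uIcc_of_le (by norm_num)]
      exact Icc_subset_Icc_right zero_le_one
    · rw [uIcc_of_le zero_le_one, uIcc_of_le (by norm_num)]
      exact Icc_subset_Icc_left (by norm_num)
  -- rule 1 on the cell: pointwise right-derivatives off the glue point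
  have hd1 : ∀ m : ℤ, dpiece (-1) 1 (glue L' R') m = I * π * m * dpiece (-1) 1 (glue L R) m := by
    have h := dcell_deriv (-1) ({0} : Finset ℝ) (S := glue L R) (S' := glue L' R') 
    simp only [show (-1:ℝ) + 2 = 1 by norm_num] at h
    exact h hFc hFd ((gl hL'i hR'i).1.trans (gl hL'i hR'i).2) hper0
  -- rule 2 on the cell: per-piece IBP on the left (right-derivatives), the GIVEN identity on the right
  have hd2 : ∀ m : ℤ, dpiece (-1) 1 (glue L'' R'') m = I * π * m * dpiece (-1) 1 (glue L' R') m := by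
    intro m
    rw [dpiece_add_adjacent (gl hL''i hR''i).1 (gl hL''i hR''i).2, dpiece_add_adjacent (gl hL'i hR'i).1 (gl hL'i hR'i).2,
      dpiece_glue_left, dpiece_glue_right, dpiece_glue_left, dpiece_glue_right,
      dpiece_deriv (by norm_num : (-1:ℝ) ≤ 0) hL'c hL'd hL''i m, hRibp m, hm1, hp1]
    have hk := dker_one_eq_dker_neg_one m
    push_cast at hk ⊢
    rw [hk]
    ring
  -- Part 1 on the cell `[−1, 1]`
  have key : 0 ≤ bulkFormOn b (-1) 1 (glue L R) (glue L' R') (glue L'' R'') := by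
    have h := bulkFormOn_cell_nonneg_of_rules_of_signAdmissible (S := glue L R) (S' := glue L' R')
      (S'' := glue L'' R'') hb (-1)
    simp only [show (-1:ℝ) + 2 = 1 by norm_num] at h
    exact h hFc hF'c hF''m hd1 hd2
  -- split at `0` and read off the pieces
  rw [bulkFormOn_add_adjacent b (x := 0) ⟨by norm_num, by norm_num⟩ hFc hF'c hF''m] at key
  have hleft : bulkFormOn b (-1) 0 (glue L R) (glue L' R') (glue L'' R'') = bulkFormOn b (-1) 0 L L' L'' := by
    unfold bulkFormOn
    refine intervalIntegral.integral_congr fun y hy => ?_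
    rw [uIcc_of_le (by norm_num)] at hy
    simp only [glue_of_le hy.2]
  have hright : bulkFormOn b 0 1 (glue L R) (glue L' R') (glue L'' R'') = bulkFormOn b 0 1 R R' R'' := by
    unfold bulkFormOn
    refine intervalIntegral.integral_congr_ae (ae_of_all _ fun y hy => ?_)
    rw [uIoc_of_le zero_le_one] at hy
    simp only [glue_of_pos hy.1]
  rwa [hleft, hright] at key

end Glued


end Det

end Literature.NumberTheory.LFunctions.Zhang2022
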